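import Summits.HubbardSuperconductivity.HubbardSuperconductivity.Theorems.DeformationLadderLadderThesisPinnedFrameBloch
import HarnessLib

/-!
# Crux `LadderThesis` (stmt-HubbardSuperconductivity-1890): frame-averaged twist ceilings, file 1 —
# the twist cost of a general flat spin-↑ frame, the orbit sum rule off the zero frame, the frame box

Negative-side support by the standing disprover of the crux (cdisprove, cycle 1; workfile
`Cruxes/LadderThesis/Disproof.lean`); consumed by `FrameAverageCeiling.lean` (file 2), where the
Bloch–Bohm/LSM test of the tree's one-frame ceilings (`PinnedFrameBloch`, p93488) is run over the whole
box of frames `mᵢ ≤ M` and averaged with the Kennedy–Lieb–Shastry sum rule (p92715).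

* `one_sub_cos_winding_sub_le`, `one_sub_cos_winding_le` — trigonometry of the bond twist angles of
  winding `m` (`1 - cos` across a torus bond is `≤ 1 - cos(2πm/L) ≤ 2π²m²/L²`);
* `re_expect_lsmPerturbation_upTwistAngle_le` — `Re⟨φ, P_{θ_k} φ⟩ ≤ 16π²(m₀² + m₁²)‖φ‖²`
  (`mᵢ = (k i).val`; the tree's `re_expect_lsmPerturbation_single_le` is `k = eᵢ`);
  `re_expect_lsmPerturbation_le_of_mem_frameBox` — `≤ 32π²M²‖φ‖²` on the box `mᵢ ≤ M`;
* `re_expect_upPenalty_nonneg`, `sum_re_expect_upPenalty_le_of_zero_not_mem`,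
  `sum_re_expect_upPenalty_neg_le_of_zero_not_mem` — off the zero frame the pair weights of a unit
  vector sum to `≤ 32L⁴ - Re⟨Δ_dᴴΔ_d⟩` (also over a reflected set `-S`);
* `sq_le_card_frameBox_erase_add_one` — the box holds `≥ (M+1)² - 1` nonzero windings when `M + 1 ≤ L`;
* `card_succ_mul_lro_le_sum_twistCost` — the Kaplan–Horsch–von der Linden / LSM pinning inequality summed
  over a set `S` of nonzero frames: `(|S|+1)·s·w(0) ≤ Σ_{k∈S} ⟨P_{θ_k}⟩_φ + 32 s` for a unit ground state
  `φ` of `H_L + (s/L⁴)Δ_dᴴΔ_d`.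

Lieb–Schultz–Mattis, Ann. Phys. 16 (1961) 407, App. B; Bohm, Phys. Rev. 75 (1949) 502;
Kennedy–Lieb–Shastry, PRL 61 (1988) 2582. No definitions; nothing asserts a Theses declaration.
-/

noncomputable section

namespace Summit.HubbardSuperconductivity.LadderThesis.Negative

open Matrix Finset Complex Literature.MathematicalPhysics.QuantumLattice
  Literature.Probability.LatticeModels HubbardWave0
open Summit.HubbardSuperconductivity.HubbardSuperconductivity.Theorems.PinnedFrame
open scoped ComplexOrder ComplexConjugate Matrix.Norms.L2Operator

/-- The twist-angle difference of winding `m` across a bond: if `a ≡ b`, `b ≡ a + 1` or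
`a ≡ b + 1 (mod L)` then `1 - cos(2πm(a - b)/L) ≤ 1 - cos(2πm/L)`.
Lieb–Schultz–Mattis (1961), App. B (the case `m = 1` is the tree's `abs_cos_sub_one_le_of_rel`). [folklore] -/
theorem one_sub_cos_winding_sub_le {L : ℕ} (hL : L ≠ 0) (m : ℕ) {a b : ℕ}
    (h : (a : ZMod L) = (b : ZMod L) ∨ (b : ZMod L) = ((a + 1 : ℕ) : ZMod L) ∨
      (a : ZMod L) = ((b + 1 : ℕ) : ZMod L)) :
    1 - Real.cos (2 * Real.pi * m / L * a - 2 * Real.pi * m / L * b) ≤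
      1 - Real.cos (2 * Real.pi * m / L) := by
  have hL' : (L : ℝ) ≠ 0 := by exact_mod_cast hL
  rcases h with h | h | h
  · rw [ZMod.natCast_eq_natCast_iff] at h
    obtain ⟨j, hj⟩ := Nat.modEq_iff_dvd.1 h
    have hj' : (b : ℝ) - a = L * j := by exact_mod_cast hj
    have hang : 2 * Real.pi * m / L * a - 2 * Real.pi * m / L * b =
        ((-((m : ℤ) * j) : ℤ) : ℝ) * (2 * Real.pi) := by
      rw [← mul_sub, show (a : ℝ) - b = -(L * j) by linarith]
      field_simp
      push_cast
      ring
    rw [hang, Real.cos_int_mul_two_pi]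
    linarith [Real.cos_le_one (2 * Real.pi * m / L)]
  · rw [ZMod.natCast_eq_natCast_iff] at h
    obtain ⟨j, hj⟩ := Nat.modEq_iff_dvd.1 h
    have hj' : ((a : ℝ) + 1) - b = L * j := by exact_mod_cast hj
    have hang : 2 * Real.pi * m / L * a - 2 * Real.pi * m / L * b =
        (((m : ℤ) * j : ℤ) : ℝ) * (2 * Real.pi) - 2 * Real.pi * m / L := by
      rw [← mul_sub, show (a : ℝ) - b = L * j - 1 by linarith]
      field_simp
      push_cast
      ring
    rw [hang, Real.cos_int_mul_two_pi_sub]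
  · rw [ZMod.natCast_eq_natCast_iff] at h
    obtain ⟨j, hj⟩ := Nat.modEq_iff_dvd.1 h
    have hj' : ((b : ℝ) + 1) - a = L * j := by exact_mod_cast hj
    have hang : 2 * Real.pi * m / L * a - 2 * Real.pi * m / L * b =
        2 * Real.pi * m / L - (((m : ℤ) * j : ℤ) : ℝ) * (2 * Real.pi) := by
      rw [← mul_sub, show (a : ℝ) - b = 1 - L * j by linarith]
      field_simp
      push_cast
      ring
    rw [hang, Real.cos_sub_int_mul_two_pi]

/-- `1 - cos(2πm/L) ≤ 2π²m²/L²`. [folklore] -/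
theorem one_sub_cos_winding_le (L m : ℕ) :
    1 - Real.cos (2 * Real.pi * m / L) ≤ 2 * Real.pi ^ 2 * (m : ℝ) ^ 2 / (L : ℝ) ^ 2 := by
  have h := Real.one_sub_sq_div_two_le_cos (x := 2 * Real.pi * m / L)
  rcases eq_or_ne L 0 with hL | hL
  · subst hL
    simp
  · have hL' : (L : ℝ) ≠ 0 := by exact_mod_cast hL
    have : (2 * Real.pi * m / L) ^ 2 / 2 = 2 * Real.pi ^ 2 * (m : ℝ) ^ 2 / (L : ℝ) ^ 2 := by
      field_simp
    linarith

variable (L : ℕ) [NeZero L]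

omit [NeZero L] in
/-- The flat spin-↑ twist angle of winding `k` at a site `u` of the fermionic torus (the tree's
`upTwistAngle_orb_up`, on `FermionTorus` rather than `TorusSite` arguments). [folklore] -/
theorem upTwistAngle_orb_zero (k : TorusSite 2 L) (u : FermionTorus 2 L) :
    upTwistAngle L k (orb u 0) = ∑ i : Fin 2, latticeMomentum L k i * ((ofLex u i : ℕ) : ℝ) := by
  simp [upTwistAngle]

/-- **Bloch/LSM twist cost of a general flat spin-↑ frame.** For every winding `k = (m₀, m₁) ∈ (ℤ/L)²`
(canonical representatives `mᵢ = (k i).val`) and every Fock vector `φ`,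
`Re⟨φ, P_{θ_k} φ⟩ ≤ 16π²(m₀² + m₁²)‖φ‖²`: each of the `≤ 4L²` ordered bonds carries the spin-↑ cost
`1 - cos(θ_k(u) - θ_k(v)) ≤ 2(1 - cos(2πm₀/L)) + 2(1 - cos(2πm₁/L)) ≤ 4π²(m₀² + m₁²)/L²` and no
spin-↓ cost. (The tree's `re_expect_lsmPerturbation_single_le` is the case `k = eᵢ`.)
Lieb–Schultz–Mattis, Ann. Phys. 16 (1961) 407, App. B; Bohm (1949). [folklore] -/
theorem re_expect_lsmPerturbation_upTwistAngle_le (k : TorusSite 2 L)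
    (φ : Fock (Orb (FermionTorus 2 L))) :
    (star φ ⬝ᵥ lsmPerturbation (fermionTorusGraph 2 L) (upTwistAngle L k) 1 *ᵥ φ).re ≤
      16 * Real.pi ^ 2 * (((k 0).val : ℝ) ^ 2 + ((k 1).val : ℝ) ^ 2) * (star φ ⬝ᵥ φ).re := by
  have hL : L ≠ 0 := NeZero.ne L
  have hL' : (L : ℝ) ≠ 0 := by exact_mod_cast hL
  have hnn : 0 ≤ (star φ ⬝ᵥ φ).re := by
    rw [Matrix.star_dotProduct_self_re]; positivity
  refine (re_expect_lsmPerturbation_le (fermionTorusGraph 2 L) (upTwistAngle L k) 1 φ).trans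
    (mul_le_mul_of_nonneg_right ?_ hnn)
  rw [abs_one, one_mul]
  -- the per-bond constant
  set c : ℝ := 2 * (1 - Real.cos (2 * Real.pi * (k 0).val / L)) +
    2 * (1 - Real.cos (2 * Real.pi * (k 1).val / L)) with hc
  have hc0 : 0 ≤ c := by
    have h0 := Real.cos_le_one (2 * Real.pi * (k 0).val / L)
    have h1 := Real.cos_le_one (2 * Real.pi * (k 1).val / L)
    rw [hc]; nlinarith
  -- termwise bound on a bond
  have hbond : ∀ u v : FermionTorus 2 L, (fermionTorusGraph 2 L).Adj u v →
      (∑ τ : Fin 2, |Real.cos (upTwistAngle L k (orb u τ) - upTwistAngle L k (orb v τ)) - 1|) ≤ c := by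
    intro u v huv
    rw [Fin.sum_univ_two, upTwistAngle_orb_down, upTwistAngle_orb_down, sub_zero, Real.cos_zero,
      sub_self, abs_zero, add_zero, upTwistAngle_orb_zero, upTwistAngle_orb_zero, Fin.sum_univ_two,
      Fin.sum_univ_two]
    -- the angle difference is `δ₀ + δ₁`
    have hδ : ∀ i : Fin 2, 1 - Real.cos (latticeMomentum L k i * ((ofLex u i : ℕ) : ℝ) -
        latticeMomentum L k i * ((ofLex v i : ℕ) : ℝ)) ≤
        1 - Real.cos (2 * Real.pi * (k i).val / L) := by
      intro i
      have h := one_sub_cos_winding_sub_le hL (k i).val (coord_rel_of_adj i huv)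
      have e : latticeMomentum L k i = 2 * Real.pi * (k i).val / L := by
        simp only [latticeMomentum]
      rw [e]
      exact h
    have h0 := hδ 0
    have h1 := hδ 1
    rw [abs_of_nonpos (by linarith [Real.cos_le_one (latticeMomentum L k 0 * ((ofLex u 0 : ℕ) : ℝ) +
        latticeMomentum L k 1 * ((ofLex u 1 : ℕ) : ℝ) -
        (latticeMomentum L k 0 * ((ofLex v 0 : ℕ) : ℝ) + latticeMomentum L k 1 * ((ofLex v 1 : ℕ) : ℝ)))])]
    have hsplit : latticeMomentum L k 0 * ((ofLex u 0 : ℕ) : ℝ) + latticeMomentum L k 1 * ((ofLex u 1 : ℕ) : ℝ) -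
        (latticeMomentum L k 0 * ((ofLex v 0 : ℕ) : ℝ) + latticeMomentum L k 1 * ((ofLex v 1 : ℕ) : ℝ)) =
        (latticeMomentum L k 0 * ((ofLex u 0 : ℕ) : ℝ) - latticeMomentum L k 0 * ((ofLex v 0 : ℕ) : ℝ)) +
        (latticeMomentum L k 1 * ((ofLex u 1 : ℕ) : ℝ) - latticeMomentum L k 1 * ((ofLex v 1 : ℕ) : ℝ)) := by
      ring
    rw [hsplit]
    -- `1 - cos(x + y) ≤ 2(1 - cos x) + 2(1 - cos y)` (`2E = (sin x - sin y)² + (cos x + cos y - 2)²`;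
    -- the tree's `BirBdG.one_sub_cos_add_le`, inlined to keep the import cone small)
    have hadd : ∀ x y : ℝ, 1 - Real.cos (x + y) ≤ 2 * (1 - Real.cos x) + 2 * (1 - Real.cos y) := by
      intro x y
      rw [Real.cos_add]
      nlinarith [Real.sin_sq_add_cos_sq x, Real.sin_sq_add_cos_sq y,
        sq_nonneg (Real.sin x - Real.sin y), sq_nonneg (Real.cos x + Real.cos y - 2)]
    have hadd := hadd
      (latticeMomentum L k 0 * ((ofLex u 0 : ℕ) : ℝ) - latticeMomentum L k 0 * ((ofLex v 0 : ℕ) : ℝ))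
      (latticeMomentum L k 1 * ((ofLex u 1 : ℕ) : ℝ) - latticeMomentum L k 1 * ((ofLex v 1 : ℕ) : ℝ))
    rw [hc]
    linarith
  -- the bond sum
  have hsum : (∑ u : FermionTorus 2 L, ∑ v : FermionTorus 2 L,
      if (fermionTorusGraph 2 L).Adj u v then
        ∑ τ : Fin 2, |Real.cos (upTwistAngle L k (orb u τ) - upTwistAngle L k (orb v τ)) - 1| else 0) ≤
      (L : ℝ) ^ 2 * (2 * (2 : ℕ)) * c := by
    refine le_trans ?_ (sum_sum_adj_const_le hc0)
    refine Finset.sum_le_sum fun u _ => Finset.sum_le_sum fun v _ => ?_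
    split_ifs with huv
    · exact hbond u v huv
    · exact le_rfl
  have hc1 : c ≤ 4 * Real.pi ^ 2 * (((k 0).val : ℝ) ^ 2 + ((k 1).val : ℝ) ^ 2) / (L : ℝ) ^ 2 := by
    have h0 := one_sub_cos_winding_le L (k 0).val
    have h1 := one_sub_cos_winding_le L (k 1).val
    rw [hc]
    have e : 4 * Real.pi ^ 2 * (((k 0).val : ℝ) ^ 2 + ((k 1).val : ℝ) ^ 2) / (L : ℝ) ^ 2 =
        2 * (2 * Real.pi ^ 2 * ((k 0).val : ℝ) ^ 2 / (L : ℝ) ^ 2) +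
          2 * (2 * Real.pi ^ 2 * ((k 1).val : ℝ) ^ 2 / (L : ℝ) ^ 2) := by ring
    rw [e]
    linarith
  calc (∑ u : FermionTorus 2 L, ∑ v : FermionTorus 2 L,
        if (fermionTorusGraph 2 L).Adj u v then
          ∑ τ : Fin 2, |Real.cos (upTwistAngle L k (orb u τ) - upTwistAngle L k (orb v τ)) - 1| else 0)
      ≤ (L : ℝ) ^ 2 * (2 * (2 : ℕ)) * c := hsum
    _ ≤ (L : ℝ) ^ 2 * (2 * (2 : ℕ)) *
        (4 * Real.pi ^ 2 * (((k 0).val : ℝ) ^ 2 + ((k 1).val : ℝ) ^ 2) / (L : ℝ) ^ 2) :=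
        mul_le_mul_of_nonneg_left hc1 (by positivity)
    _ = 16 * Real.pi ^ 2 * (((k 0).val : ℝ) ^ 2 + ((k 1).val : ℝ) ^ 2) := by
        field_simp
        push_cast
        ring

/-! ### Pair weights of the frames: nonnegativity, the zero frame -/

/-- `Re⟨ψ, Δ↑_d(k)ᴴ Δ↑_d(k) ψ⟩ = ‖Δ↑_d(k)ψ‖² ≥ 0`. [folklore] -/
theorem re_expect_upPenalty_nonneg (k : TorusSite 2 L) (ψ : Fock (Orb (FermionTorus 2 L))) :
    0 ≤ (star ψ ⬝ᵥ (((upPairFieldAt dWaveFormFactor L k)ᴴ * upPairFieldAt dWaveFormFactor L k) *ᵥ ψ)).re := by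
  rw [← Literature.MathematicalPhysics.QuantumLattice.star_mulVec_dotProduct_mulVec]
  exact (Complex.nonneg_iff.1 (dotProduct_star_self_nonneg _)).1

/-- Off the zero frame the pair weights sum to at most `32L⁴ - Re⟨Δ_dᴴΔ_d⟩`: for a unit vector `ψ`
and a set `S` of NONZERO windings, `Σ_{k∈S} Re⟨Δ↑_d(k)ᴴΔ↑_d(k)⟩_ψ ≤ 32L⁴ - Re⟨Δ_dᴴΔ_d⟩_ψ`
(Kennedy–Lieb–Shastry sum rule `sum_re_expect_upPenalty_dWave_le`, `Δ↑_d(0) = Δ_d`). [folklore] -/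
theorem sum_re_expect_upPenalty_le_of_zero_not_mem {ψ : Fock (Orb (FermionTorus 2 L))}
    (hψ : star ψ ⬝ᵥ ψ = 1) (S : Finset (TorusSite 2 L)) (h0 : (0 : TorusSite 2 L) ∉ S) :
    ∑ k ∈ S, (star ψ ⬝ᵥ (((upPairFieldAt dWaveFormFactor L k)ᴴ * upPairFieldAt dWaveFormFactor L k) *ᵥ ψ)).re ≤
      32 * (L : ℝ) ^ 4 -
        (star ψ ⬝ᵥ (((pairField dWaveFormFactor L)ᴴ * pairField dWaveFormFactor L) *ᵥ ψ)).re := by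
  set w : TorusSite 2 L → ℝ := fun k =>
    (star ψ ⬝ᵥ (((upPairFieldAt dWaveFormFactor L k)ᴴ * upPairFieldAt dWaveFormFactor L k) *ᵥ ψ)).re
    with hw
  have hw0 : ∀ k, 0 ≤ w k := fun k => re_expect_upPenalty_nonneg L k ψ
  have hsum : ∑ k, w k ≤ 32 * (L : ℝ) ^ 4 := sum_re_expect_upPenalty_dWave_le L hψ
  have hzero : w 0 = (star ψ ⬝ᵥ (((pairField dWaveFormFactor L)ᴴ * pairField dWaveFormFactor L) *ᵥ ψ)).re := by
    simp only [hw, upPairFieldAt_dWave_zero]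
  have hsub : S ⊆ Finset.univ.erase 0 := fun k hk =>
    Finset.mem_erase.2 ⟨fun h => h0 (h ▸ hk), Finset.mem_univ _⟩
  have h1 : ∑ k ∈ S, w k ≤ ∑ k ∈ Finset.univ.erase 0, w k :=
    Finset.sum_le_sum_of_subset_of_nonneg hsub fun k _ _ => hw0 k
  have h2 : ∑ k ∈ Finset.univ.erase 0, w k + w 0 = ∑ k, w k :=
    Finset.sum_erase_add _ _ (Finset.mem_univ _)
  show ∑ k ∈ S, w k ≤ 32 * (L : ℝ) ^ 4 -
    (star ψ ⬝ᵥ (((pairField dWaveFormFactor L)ᴴ * pairField dWaveFormFactor L) *ᵥ ψ)).re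
  rw [← hzero]
  linarith

/-- The same bound for the reflected set `-S`: `Σ_{k∈S} Re⟨Δ↑_d(-k)ᴴΔ↑_d(-k)⟩_ψ ≤ 32L⁴ - Re⟨Δ_dᴴΔ_d⟩_ψ`. [folklore] -/
theorem sum_re_expect_upPenalty_neg_le_of_zero_not_mem {ψ : Fock (Orb (FermionTorus 2 L))}
    (hψ : star ψ ⬝ᵥ ψ = 1) (S : Finset (TorusSite 2 L)) (h0 : (0 : TorusSite 2 L) ∉ S) :
    ∑ k ∈ S, (star ψ ⬝ᵥ (((upPairFieldAt dWaveFormFactor L (-k))ᴴ *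
        upPairFieldAt dWaveFormFactor L (-k)) *ᵥ ψ)).re ≤
      32 * (L : ℝ) ^ 4 -
        (star ψ ⬝ᵥ (((pairField dWaveFormFactor L)ᴴ * pairField dWaveFormFactor L) *ᵥ ψ)).re := by
  classical
  have hinj : ∀ x ∈ S, ∀ y ∈ S, -x = -y → x = y := fun x _ y _ h => neg_injective h
  have himg := Finset.sum_image (f := fun k : TorusSite 2 L =>
    (star ψ ⬝ᵥ (((upPairFieldAt dWaveFormFactor L k)ᴴ * upPairFieldAt dWaveFormFactor L k) *ᵥ ψ)).re)
    hinj
  rw [← himg]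
  refine sum_re_expect_upPenalty_le_of_zero_not_mem L hψ _ fun h => ?_
  obtain ⟨k, hk, hk0⟩ := Finset.mem_image.1 h
  exact h0 ((neg_eq_zero.1 hk0) ▸ hk)

/-! ### The box of frames `|mᵢ| ≤ M` -/

/-- For `M + 1 ≤ L` the windings `k` with representatives `(k i).val ≤ M` (`i = 0, 1`) number at least
`(M+1)²`; removing the origin leaves at least `(M+1)² - 1`. [folklore] -/
theorem sq_le_card_frameBox_erase_add_one (M : ℕ) (hM : M + 1 ≤ L) :
    ((M : ℝ) + 1) ^ 2 ≤
      ((((Finset.univ : Finset (TorusSite 2 L)).filter fun k => ∀ i, (k i).val ≤ M).erase 0).card : ℝ) + 1 := by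
  classical
  set B : Finset (TorusSite 2 L) := Finset.univ.filter fun k => ∀ i, (k i).val ≤ M with hB
  have h0B : (0 : TorusSite 2 L) ∈ B := by
    rw [hB, Finset.mem_filter]
    exact ⟨Finset.mem_univ _, fun i => by simp⟩
  have hcard : (B.erase 0).card + 1 = B.card := Finset.card_erase_add_one h0B
  -- the injection `(Fin 2 → Fin (M+1)) → B`, `v ↦ (i ↦ v i mod L)`
  let f : (Fin 2 → Fin (M + 1)) → TorusSite 2 L := fun v i => ((v i : ℕ) : ZMod L)
  have hval : ∀ (v : Fin 2 → Fin (M + 1)) (i : Fin 2), (f v i).val = (v i : ℕ) := by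
    intro v i
    show (((v i : ℕ) : ZMod L)).val = (v i : ℕ)
    rw [ZMod.val_natCast]
    exact Nat.mod_eq_of_lt (lt_of_lt_of_le (v i).isLt hM)
  have hmaps : ∀ v ∈ (Finset.univ : Finset (Fin 2 → Fin (M + 1))), f v ∈ B := by
    intro v _
    rw [hB, Finset.mem_filter]
    refine ⟨Finset.mem_univ _, fun i => ?_⟩
    rw [hval]
    exact Nat.lt_succ_iff.1 (v i).isLt
  have hinj : Set.InjOn f (Finset.univ : Finset (Fin 2 → Fin (M + 1))) := by
    intro v _ v' _ hvv
    funext i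
    apply Fin.ext
    have h : (f v i).val = (f v' i).val := by rw [hvv]
    rwa [hval, hval] at h
  have hle := Finset.card_le_card_of_injOn f hmaps hinj
  rw [Finset.card_univ, Fintype.card_fun, Fintype.card_fin, Fintype.card_fin] at hle
  have hle' : ((M + 1) ^ 2 : ℕ) ≤ (B.erase 0).card + 1 := by rw [hcard]; simpa [sq] using hle
  exact_mod_cast hle'

/-- On the box, the twist cost is at most `32π²M²`: for `k` with `(k i).val ≤ M`,
`Re⟨φ, P_{θ_k} φ⟩ ≤ 32π²M²‖φ‖²`. [folklore] -/
theorem re_expect_lsmPerturbation_le_of_mem_frameBox {M : ℕ} {k : TorusSite 2 L}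
    (hk : ∀ i, (k i).val ≤ M) (φ : Fock (Orb (FermionTorus 2 L))) :
    (star φ ⬝ᵥ lsmPerturbation (fermionTorusGraph 2 L) (upTwistAngle L k) 1 *ᵥ φ).re ≤
      32 * Real.pi ^ 2 * (M : ℝ) ^ 2 * (star φ ⬝ᵥ φ).re := by
  have hnn : 0 ≤ (star φ ⬝ᵥ φ).re := by
    rw [Matrix.star_dotProduct_self_re]; positivity
  refine (re_expect_lsmPerturbation_upTwistAngle_le L k φ).trans (mul_le_mul_of_nonneg_right ?_ hnn)
  have h0 : ((k 0).val : ℝ) ≤ M := by exact_mod_cast hk 0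
  have h1 : ((k 1).val : ℝ) ≤ M := by exact_mod_cast hk 1
  have h0' : (0 : ℝ) ≤ (k 0).val := Nat.cast_nonneg _
  have h1' : (0 : ℝ) ≤ (k 1).val := Nat.cast_nonneg _
  have hpi : 0 ≤ Real.pi ^ 2 := by positivity
  nlinarith [mul_le_mul h0 h0 h0' (Nat.cast_nonneg M), mul_le_mul h1 h1 h1' (Nat.cast_nonneg M)]


/-! ### The Kaplan–Horsch–von der Linden / LSM inequality, summed over a set of frames -/

/-- **Frame-summed pinning inequality.** Let `φ` be a unit ground state of
`H_L + (s/L⁴)Δ_dᴴΔ_d` (`s ≥ 0`) in a joint sector and `S` a set of nonzero windings. Summing the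
per-frame ceiling `s·w(0) ≤ ⟨P_{θ_k}⟩_φ + (s/2)(w(k) + w(-k))` (`smul_re_expect_pairPenalty_le_of_groundState`,
`w(k) = L⁻⁴Re⟨Δ↑_d(k)ᴴΔ↑_d(k)⟩_φ`) over `k ∈ S` and using the sum rule `Σ_{k≠0} w(k) ≤ 32 - w(0)` gives
`(|S| + 1)·s·w(0) ≤ Σ_{k∈S} ⟨P_{θ_k}⟩_φ + 32 s`. [folklore] -/
theorem card_succ_mul_lro_le_sum_twistCost (U : ℝ) {s : ℝ} (hs : 0 ≤ s) {N : ℕ} {Mz : ℝ}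
    {φ : Fock (Orb (FermionTorus 2 L))} (hφ1 : star φ ⬝ᵥ φ = 1)
    (hφ : IsGroundStateInSector (hubbardTorus 2 L 1 U + ((s / (L : ℝ) ^ 4 : ℝ) : ℂ) •
      ((pairField dWaveFormFactor L)ᴴ * pairField dWaveFormFactor L)) N Mz φ)
    (S : Finset (TorusSite 2 L)) (h0 : (0 : TorusSite 2 L) ∉ S) :
    ((S.card : ℝ) + 1) * s *
        ((expect ((pairField dWaveFormFactor L)ᴴ * pairField dWaveFormFactor L) φ).re / (L : ℝ) ^ 4) ≤
      ∑ k ∈ S, (star φ ⬝ᵥ lsmPerturbation (fermionTorusGraph 2 L) (upTwistAngle L k) 1 *ᵥ φ).re +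
        32 * s := by
  have hL0 : (0 : ℝ) < L := by exact_mod_cast Nat.pos_of_ne_zero (NeZero.ne L)
  have hL4 : (0 : ℝ) < (L : ℝ) ^ 4 := by positivity
  set P : ℝ := (star φ ⬝ᵥ (((pairField dWaveFormFactor L)ᴴ * pairField dWaveFormFactor L) *ᵥ φ)).re
    with hP
  set w : TorusSite 2 L → ℝ := fun k =>
    (star φ ⬝ᵥ (((upPairFieldAt dWaveFormFactor L k)ᴴ * upPairFieldAt dWaveFormFactor L k) *ᵥ φ)).re
    with hw
  set cost : TorusSite 2 L → ℝ := fun k =>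
    (star φ ⬝ᵥ lsmPerturbation (fermionTorusGraph 2 L) (upTwistAngle L k) 1 *ᵥ φ).re with hcost
  -- the per-frame ceilings, summed
  have hk : ∀ k ∈ S, s / (L : ℝ) ^ 4 * P ≤ cost k + s / (L : ℝ) ^ 4 / 2 * (w k + w (-k)) :=
    fun k _ => smul_re_expect_pairPenalty_le_of_groundState L U s k hφ1 hφ
  have hsumk := Finset.sum_le_sum hk
  rw [Finset.sum_const, nsmul_eq_mul, Finset.sum_add_distrib, ← Finset.mul_sum,
    Finset.sum_add_distrib] at hsumk
  -- the sum rule off the zero frame, for `S` and for `-S`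
  have h1 : ∑ k ∈ S, w k ≤ 32 * (L : ℝ) ^ 4 - P :=
    sum_re_expect_upPenalty_le_of_zero_not_mem L hφ1 S h0
  have h2 : ∑ k ∈ S, w (-k) ≤ 32 * (L : ℝ) ^ 4 - P :=
    sum_re_expect_upPenalty_neg_le_of_zero_not_mem L hφ1 S h0
  have hs4 : 0 ≤ s / (L : ℝ) ^ 4 / 2 := by positivity
  have h3 : s / (L : ℝ) ^ 4 / 2 * (∑ k ∈ S, w k + ∑ k ∈ S, w (-k)) ≤
      s / (L : ℝ) ^ 4 / 2 * (2 * (32 * (L : ℝ) ^ 4 - P)) :=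
    mul_le_mul_of_nonneg_left (by linarith) hs4
  have hexp : (expect ((pairField dWaveFormFactor L)ᴴ * pairField dWaveFormFactor L) φ).re = P := rfl
  rw [hexp]
  -- bookkeeping: `(|S|+1)(s/L⁴)P ≤ Σ cost + 32 s`
  have key : ((S.card : ℝ) + 1) * (s / (L : ℝ) ^ 4 * P) ≤ ∑ k ∈ S, cost k + 32 * s := by
    have e : s / (L : ℝ) ^ 4 / 2 * (2 * (32 * (L : ℝ) ^ 4 - P)) = 32 * s - s / (L : ℝ) ^ 4 * P := by
      field_simp
    rw [e] at h3
    nlinarith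
  calc ((S.card : ℝ) + 1) * s * (P / (L : ℝ) ^ 4)
      = ((S.card : ℝ) + 1) * (s / (L : ℝ) ^ 4 * P) := by ring
    _ ≤ ∑ k ∈ S, cost k + 32 * s := key


end Summit.HubbardSuperconductivity.LadderThesis.Negative
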